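import Summits.KontsevichZagierPeriods.KontsevichZagierPeriods.Theorems.FurushoPentagonHoffmanRelationInKZStuffleDissection

/-!
# `DoubleShuffleInKZ` (stmt-KontsevichZagierPeriods-14665, route `FurushoPentagon`): block partial fractions from a block on

Helper file (`--supports stmt-KontsevichZagierPeriods-14665`), line "rider lever" for the
Kaneko–Yamamoto integral–series family `IS_j(u)`.  The exact rational identity behind the stuffle
side of the `HoffmanRelationInKZ` line (`stuffle_telescope`, `stuffle_integrand_eq`: the difference
quotient `(f_s(x) − u f_s(u x₀, x'))/(1 − u)` of the cubical integrand splits into the cubical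
integrands of the raised / inserted indices) is redone for the dilation at the FIRST SLOT
`q = p_m` OF AN ARBITRARY BLOCK `m`:

  `(f_w(x) − u·f_w(x|_{q := u x_q}))/(1 − u) = Σ_{m ≤ i < k} (g_i(u, x) + h_i(u, x))`,

where `g_i` / `h_i` are the closed forms (`HoffmanRelationInKZ.cubical_raise_at_perm` /
`…cubical_insertOne_at_perm`) of the cubical integrands of `(…, w_i + 1, …)` / `(…, w_i, 1, …)` read
at the point `(u, x)` with `u` moved into block `i` / as the new block after block `i`
(`stuffle_integrand_eq_from`).  Only the blocks `i ≥ m` occur: the series shadow is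
`S_j(n_{m+1}) = Σ_{n' ≤ n_{m+1}} S_{j-1}(n')/n'`, the new summation variable being placed at or below
block `m`.  Pure algebra (telescoping `HoffmanRelationInKZ.stuffle_block` from `m` to `k`).

References: K. Ihara, M. Kaneko, D. Zagier, Compos. Math. 142 (2006), Thm 2; M. E. Hoffman,
Pacific J. Math. 152 (1992), Thm 5.1; M. Kaneko, S. Yamamoto, Selecta Math. 24 (2018), Thm 4.1.
-/

noncomputable section

open Set Finset
open Literature.NumberTheory.Transcendental
open Summit.KontsevichZagierPeriods.FurushoPentagon.HoffmanRelationInKZ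

namespace Summit.KontsevichZagierPeriods.FurushoPentagon.DoubleShuffleInKZ

/-! ### The telescoping identity from block `m` on -/

/-- `∏_{l<k} (if m < l then u else 1) = u^{k-m-1}` for `m < k`. [folklore] -/
theorem prod_range_ite_lt (u : ℝ) {k m : ℕ} (hmk : m < k) :
    ∏ l ∈ range k, (if m < l then u else (1 : ℝ)) = u ^ (k - m - 1) := by
  induction k with
  | zero => omega
  | succ k ih =>
    rw [prod_range_succ]
    rcases Nat.lt_succ_iff_lt_or_eq.mp hmk with h | h
    · rw [ih h, if_pos h, ← pow_succ]
      congr 1; omega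
    · subst h
      rw [if_neg (lt_irrefl _), mul_one]
      have h0 : m + 1 - m - 1 = 0 := by omega
      rw [h0, pow_zero]
      exact prod_eq_one fun l hl => if_neg (by have := mem_range.mp hl; omega)

/-- **The stuffle dissection identity from block `m` on** (telescoping `stuffle_block` over
`m ≤ i < k`): for `a 0` arbitrary, `a_j < 1` (`j ≥ 1`), `0 < u < 1`, `m < k`,
`(∏_{l<k} a_l/(1−a_{l+1}) − u·∏_{l<k} ([m<l] u) a_l/(1 − ([m≤l] u) a_{l+1}))/(1 − u) = ∑_{m≤i<k} (g_i + h_i)`.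
[cite: IharaKanekoZagier2006, Thm 2] -/
theorem stuffle_telescope_from {k m : ℕ} (hmk : m < k) {u : ℝ} (hu0 : 0 < u) (hu1 : u < 1)
    {a : ℕ → ℝ} (ha : ∀ j, 1 ≤ j → a j < 1) :
    ((∏ l ∈ range k, a l / (1 - a (l + 1))) -
        u * ∏ l ∈ range k, (if m < l then u else 1) * a l /
          (1 - (if m ≤ l then u else 1) * a (l + 1))) / (1 - u) =
      ∑ i ∈ Finset.Ico m k,
        ((∏ l ∈ range k, (if l ≤ i then a l else u * a l) /
            (1 - (if l + 1 ≤ i then a (l + 1) else u * a (l + 1)))) +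
          ∏ l ∈ range (k + 1), (if l ≤ i + 1 then a l else u * a (l - 1)) /
            (1 - (if l ≤ i then a (l + 1) else u * a l))) := by
  rw [sum_congr rfl fun i hi => stuffle_block (mem_Ico.mp hi).2 hu0 hu1 ha]
  -- telescope over `i ∈ [m, k)`
  set Q : ℕ → ℝ := fun i => (∏ l ∈ range k, a l) * (u ^ (k - i) /
    ∏ l ∈ range k, (1 - (if l + 1 ≤ i then a (l + 1) else u * a (l + 1)))) / (1 - u) with hQ
  have hsplit : ∀ i ∈ Finset.Ico m k, (∏ l ∈ range k, a l) *
      (u ^ (k - (i + 1)) / ∏ l ∈ range k, (1 - (if l + 1 ≤ i + 1 then a (l + 1) else u * a (l + 1))) -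
        u ^ (k - i) / ∏ l ∈ range k, (1 - (if l + 1 ≤ i then a (l + 1) else u * a (l + 1)))) /
      (1 - u) = Q (i + 1) - Q i := fun i _ => by simp only [hQ]; ring
  rw [sum_congr rfl hsplit, sum_Ico_eq_sum_range]
  have htel := sum_range_sub (fun t => Q (m + t)) (k - m)
  have hshift : ∑ t ∈ range (k - m), (Q (m + t + 1) - Q (m + t)) =
      ∑ t ∈ range (k - m), (Q (m + (t + 1)) - Q (m + t)) :=
    sum_congr rfl fun t _ => by rw [add_assoc]
  rw [hshift, htel, show m + (k - m) = k by omega, Nat.add_zero]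
  -- identify the two ends
  have hQk : ∏ l ∈ range k, (1 - (if l + 1 ≤ k then a (l + 1) else u * a (l + 1))) =
      ∏ l ∈ range k, (1 - a (l + 1)) :=
    prod_congr rfl fun l hl => by rw [if_pos (show l + 1 ≤ k from mem_range.mp hl)]
  have hQm : ∏ l ∈ range k, (1 - (if l + 1 ≤ m then a (l + 1) else u * a (l + 1))) =
      ∏ l ∈ range k, (1 - (if m ≤ l then u else 1) * a (l + 1)) :=
    prod_congr rfl fun l _ => by
      by_cases h : m ≤ l
      · rw [if_neg (by omega), if_pos h]
      · rw [if_pos (by omega), if_neg h, one_mul]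
  simp only [hQ]
  rw [Nat.sub_self, pow_zero, hQk, hQm, prod_div_distrib, prod_div_distrib, prod_mul_distrib,
    prod_range_ite_lt u hmk]
  have hD : ∏ l ∈ range k, (1 - a (l + 1)) ≠ 0 :=
    prod_ne_zero_iff.mpr fun l _ => (sub_pos.mpr (ha (l + 1) (Nat.succ_pos l))).ne'
  have hF : ∏ l ∈ range k, (1 - (if m ≤ l then u else 1) * a (l + 1)) ≠ 0 :=
    prod_ne_zero_iff.mpr fun l _ => by
      split_ifs
      · exact (sub_pos.mpr (mul_lt_one_of_lt hu0 hu1 (ha (l + 1) (Nat.succ_pos l)))).ne'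
      · rw [one_mul]; exact (sub_pos.mpr (ha (l + 1) (Nat.succ_pos l))).ne'
  have hu : 1 - u ≠ 0 := (sub_pos.mpr hu1).ne'
  have hpow : u ^ (k - m) = u * u ^ (k - m - 1) := by
    rw [← pow_succ']; congr 1; omega
  rw [hpow]
  field_simp

/-! ### Partial products at the dilated point -/

/-- **Partial products at the point dilated in the coordinate `q`**:
`∏_{t<r} (σ_c x)_t = c^{[q<r]} ∏_{t<r} x_t` for `σ_c x = x|_{q := c x_q}`. [folklore] -/
theorem prod_ite_sigma {n : ℕ} (q : ℕ) (hq : q < n) (c : ℝ) (x z : Fin n → ℝ)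
    (hz : ∀ t, z t = if (t : ℕ) = q then c * x t else x t) (r : ℕ) :
    ∏ t : Fin n, (if (t : ℕ) < r then z t else 1) =
      (if q < r then c else 1) * ∏ t : Fin n, (if (t : ℕ) < r then x t else 1) := by
  have hmem : (⟨q, hq⟩ : Fin n) ∈ (Finset.univ : Finset (Fin n)) := Finset.mem_univ _
  rw [← mul_prod_erase _ _ hmem, ← mul_prod_erase _ (fun t : Fin n => if (t : ℕ) < r then x t else 1) hmem]
  have hrest : ∏ t ∈ univ.erase (⟨q, hq⟩ : Fin n), (if (t : ℕ) < r then z t else 1) =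
      ∏ t ∈ univ.erase (⟨q, hq⟩ : Fin n), (if (t : ℕ) < r then x t else 1) := by
    refine prod_congr rfl fun t ht => ?_
    have htq : (t : ℕ) ≠ q := fun h => ne_of_mem_erase ht (Fin.ext h)
    rw [hz t, if_neg htq]
  rw [hrest, hz]
  simp only [if_true]
  by_cases h : q < r
  · simp only [if_pos h]; ring
  · simp only [if_neg h]; ring

/-- **The dilated stuffle integrand splits, from block `m` on.** For a non-empty admissible `s`
(depth `k`), `m < k`, `q = p_m`, the cubical integrand `f` and the dilation `σ_c x = x|_{q := c x_q}`:
at every point `y = (u, x)` of the open cube,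
`(f(x) − u f(σ_u x))/(1 − u) = ∑_{m ≤ i < k} (g_i(y) + h_i(y))`, with `g_i`, `h_i` the closed forms of
`cubical_raise_at_perm` / `cubical_insertOne_at_perm`. [cite: IharaKanekoZagier2006, Thm 2] -/
theorem stuffle_integrand_eq_from (s : List ℕ) (hs : MZV.IsAdmissible s) (hne : s ≠ [])
    {m : ℕ} (hm : m < s.length)
    (f : (Fin (MZV.weight s) → ℝ) → ℝ) (σ : ℝ → (Fin (MZV.weight s) → ℝ) → (Fin (MZV.weight s) → ℝ))
    (hf : ∀ x, f x = ∏ l : Fin s.length, (∏ j : Fin (MZV.weight s),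
      if (j : ℕ) < (s.take l).sum then x j else 1) / (1 - (∏ j : Fin (MZV.weight s),
      if (j : ℕ) < (s.take ((l : ℕ) + 1)).sum then x j else 1)))
    (hσ : ∀ (c : ℝ) (x : Fin (MZV.weight s) → ℝ) (j : Fin (MZV.weight s)),
      σ c x j = if (j : ℕ) = (s.take m).sum then c * x j else x j)
    (y : Fin (MZV.weight s + 1) → ℝ) (hy : ∀ i, y i ∈ Set.Ioo (0 : ℝ) 1) :
    (f (Fin.tail y) - y 0 * f (σ (y 0) (Fin.tail y))) / (1 - y 0) =
      ∑ i ∈ Finset.Ico m s.length,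
        ((∏ l ∈ range s.length,
          (if l ≤ i then (∏ j : Fin (MZV.weight s), if (j : ℕ) < (s.take l).sum then y j.succ else 1)
            else y 0 * ∏ j : Fin (MZV.weight s), if (j : ℕ) < (s.take l).sum then y j.succ else 1) /
          (1 - (if l + 1 ≤ i
            then (∏ j : Fin (MZV.weight s), if (j : ℕ) < (s.take (l + 1)).sum then y j.succ else 1)
            else y 0 * ∏ j : Fin (MZV.weight s),
              if (j : ℕ) < (s.take (l + 1)).sum then y j.succ else 1))) +
        ∏ l ∈ range (s.length + 1),
          (if l ≤ i + 1 then (∏ j : Fin (MZV.weight s), if (j : ℕ) < (s.take l).sum then y j.succ else 1)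
            else y 0 * ∏ j : Fin (MZV.weight s), if (j : ℕ) < (s.take (l - 1)).sum then y j.succ else 1) /
          (1 - (if l ≤ i
            then (∏ j : Fin (MZV.weight s), if (j : ℕ) < (s.take (l + 1)).sum then y j.succ else 1)
            else y 0 * ∏ j : Fin (MZV.weight s),
              if (j : ℕ) < (s.take l).sum then y j.succ else 1))) := by
  have hk : 1 ≤ s.length := List.length_pos_of_ne_nil hne
  have hp : ∀ l, 1 ≤ l → 0 < (s.take l).sum := by
    obtain ⟨b, t, rfl⟩ := List.exists_cons_of_ne_nil hne
    have hb : 2 ≤ b := hs.2 (List.cons_ne_nil b t)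
    exact fun l hl => sum_take_pos (by omega) t hl
  have hn : 0 < MZV.weight s := by
    have := hp s.length hk
    rwa [List.take_length] at this
  have hq : (s.take m).sum < MZV.weight s := by
    have h1 : (s.take m).sum < (s.take (m + 1)).sum := by
      have hall : ∀ a ∈ s, 1 ≤ a := hs.1
      rw [← List.take_append_getElem (show m < s.length from hm), List.sum_append, List.sum_singleton]
      have : 1 ≤ s[m] := hall _ (List.getElem_mem _)
      omega
    exact lt_of_lt_of_le h1 (by simpa [MZV.weight] using sum_take_le_sum s (m + 1))
  have hy' : ∀ i : Fin (MZV.weight s), y i.succ ∈ Set.Ioo (0 : ℝ) 1 := fun i => hy i.succ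
  have ha1 : ∀ j, 1 ≤ j →
      (fun l => ∏ j : Fin (MZV.weight s), if (j : ℕ) < (s.take l).sum then y j.succ else 1) j < 1 :=
    fun j hj => prod_ite_lt_one hn (fun i => y i.succ) hy' (hp j hj)
  have key := stuffle_telescope_from
    (a := fun l => ∏ j : Fin (MZV.weight s), if (j : ℕ) < (s.take l).sum then y j.succ else 1)
    hm (hy 0).1 (hy 0).2 ha1
  rw [← key]
  have htail : Fin.tail y = fun i => y i.succ := rfl
  rw [htail, hf, hf]
  -- block ends versus the slot: `q < p_l ↔ m < l`
  have hmono : ∀ l l' : ℕ, l < l' → l' ≤ s.length → (s.take l).sum < (s.take l').sum := by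
    intro l l' hll' hl'
    have hall : ∀ a ∈ s, 1 ≤ a := hs.1
    have h1 : (s.take l).sum < (s.take (l + 1)).sum := by
      rw [← List.take_append_getElem (show l < s.length by omega), List.sum_append,
        List.sum_singleton]
      have : 1 ≤ s[l] := hall _ (List.getElem_mem _)
      omega
    exact lt_of_lt_of_le h1 (sum_take_mono s (by omega))
  have hiff : ∀ l : ℕ, l ≤ s.length → ((s.take m).sum < (s.take l).sum ↔ m < l) := by
    intro l hl
    constructor
    · intro h
      by_contra hle
      rcases (not_lt.mp hle).lt_or_eq with hlt | rfl
      · exact absurd (hmono l m hlt hm.le) (not_lt.mpr h.le)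
      · exact lt_irrefl _ h
    · intro h
      exact hmono m l h hl
  simp_rw [prod_ite_sigma (s.take m).sum hq (y 0) (fun i => y i.succ) (σ (y 0) fun i => y i.succ)
    (hσ (y 0) fun i => y i.succ)]
  rw [Fin.prod_univ_eq_prod_range (fun l => (∏ j : Fin (MZV.weight s),
      if (j : ℕ) < (s.take l).sum then y j.succ else 1) / (1 - ∏ j : Fin (MZV.weight s),
      if (j : ℕ) < (s.take (l + 1)).sum then y j.succ else 1)) s.length,
    Fin.prod_univ_eq_prod_range (fun l => ((if (s.take m).sum < (s.take l).sum then y 0 else 1) *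
      ∏ j : Fin (MZV.weight s), if (j : ℕ) < (s.take l).sum then y j.succ else 1) /
      (1 - (if (s.take m).sum < (s.take (l + 1)).sum then y 0 else 1) *
      ∏ j : Fin (MZV.weight s), if (j : ℕ) < (s.take (l + 1)).sum then y j.succ else 1)) s.length]
  have hY : ∏ l ∈ range s.length, ((if (s.take m).sum < (s.take l).sum then y 0 else 1) *
      ∏ j : Fin (MZV.weight s), if (j : ℕ) < (s.take l).sum then y j.succ else 1) /
      (1 - (if (s.take m).sum < (s.take (l + 1)).sum then y 0 else 1) *
      ∏ j : Fin (MZV.weight s), if (j : ℕ) < (s.take (l + 1)).sum then y j.succ else 1) =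
      ∏ l ∈ range s.length, (if m < l then y 0 else 1) *
      (∏ j : Fin (MZV.weight s), if (j : ℕ) < (s.take l).sum then y j.succ else 1) /
      (1 - (if m ≤ l then y 0 else 1) *
        ∏ j : Fin (MZV.weight s), if (j : ℕ) < (s.take (l + 1)).sum then y j.succ else 1) := by
    refine prod_congr rfl fun l hl => ?_
    have hl : l < s.length := mem_range.mp hl
    have h1 := hiff l hl.le
    have h2 := hiff (l + 1) hl
    have e1 : (if (s.take m).sum < (s.take l).sum then y 0 else 1) = (if m < l then y 0 else 1) := by
      by_cases h : m < l
      · rw [if_pos (h1.mpr h), if_pos h]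
      · rw [if_neg (fun h' => h (h1.mp h')), if_neg h]
    have e2 : (if (s.take m).sum < (s.take (l + 1)).sum then y 0 else 1) = (if m ≤ l then y 0 else 1) := by
      by_cases h : m ≤ l
      · rw [if_pos (h2.mpr (Nat.lt_succ_of_le h)), if_pos h]
      · rw [if_neg (fun h' => h (Nat.lt_succ_iff.mp (h2.mp h'))), if_neg h]
    rw [e1, e2]
  rw [hY]

end Summit.KontsevichZagierPeriods.FurushoPentagon.DoubleShuffleInKZ
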